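import Summits.CriticalPhenomena.PercolationContinuityZ3.Theorems.PercNearOneGluingNoHeavyRsw3InvasionWMSFNeighboursFinite
import HarnessLib

/-!
# RSW3 lane (P2, gen 29): INVASION PERCOLATION XXXIX — THE CANONICAL END: the backbones of the invasion trees of any two vertices joined by WMSF bonds SHARE A TAIL
# (every infinite connected locally finite graph with injective labels and outlets beyond every time; a.s. on `ℤ^d`, `d ≥ 2`, p205010)

builds on p205010 (kernel theorem, internal audit signed; external expert review pending) — used only in the `ℤ^d` statement (through files XXX/XXXVI/XXXVII).

Cell `prim-rsw3`, prover seat `prim-rsw3-p2` (gen 29), memo `run/shared/lean/prim/rsw3/P2-RSWLITE.md` §36.  Support file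
(`--supports stmt-CriticalPhenomena-4575`); no definitions, no named facts, no sorries.

Lyons–Peres–Schramm 2006, proof of Thm. 3.12: "all invasion trees have one end a.s. Since each pair of invasion trees is either disjoint or shares all but finitely
many vertices by Proposition 3.4, there is a well-defined special end for each component of `𝔉_w`."  Kernel version of the "special end":

* **`ray_tail_of_ray_from_vertex`** (splice lemma) — in the invasion tree with outlets beyond every time (acyclic, unique ray `R` from the root, files XXXIII/XXXV), every
  self-avoiding ray `r` from ANY invaded vertex shares a tail with `R`: `R (i₀ + k) = r (j + k)` for all `k` (splice the root path with the last exit of `r` from it).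
* **`rays_tail_equivalent_of_mem_wmsf`** — injective labels, `s(x, y) ∈ 𝔉_w`, outlets beyond every time at `x` and at `y`: the backbones `R_x`, `R_y` share a tail
  (Prop. 3.4 tree form, file XXXVIII: the bonds of `R_y` lie eventually in `T(x)`); `rays_tail_equivalent_of_wmsf_reachable` along WMSF paths.
* **`ae_rays_tail_equivalent_of_wmsf_reachable`** (`ℤ^d`, `d ≥ 2`): a.s., for all `x, y` joined by WMSF bonds and all rays `r_x` from `x` in `T(x)`, `r_y` from `y` in `T(y)`:
  `∃ a b, ∀ k, r_x (a + k) = r_y (b + k)` — EVERY WMSF COMPONENT OF `ℤ^d` HAS A CANONICAL END to which all the backbones of its vertices' invasion trees belong.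
  (That it is the ONLY end of the component — the full Thm 3.12 — needs a mass-transport argument; not claimed.)

References: R. Lyons, Y. Peres, O. Schramm, Ann. Probab. 34 (2006), Prop. 3.4 and Thm. 3.12 (proof) [LyonsPeresSchramm2006].
-/

noncomputable section

namespace Summit.CriticalPhenomena.PercolationContinuityZ3.Theorems.Rsw3

open Finset Filter MeasureTheory Literature.Probability.LatticeModels Literature.Probability.Percolation Literature.Probability.Percolation.Invasion

section General

variable {V : Type*} [DecidableEq V] {G : SimpleGraph V} [G.LocallyFinite]

/-- **Splice lemma.**  In the invasion tree from `o` (infinite connected graph, outlets beyond every time — so the tree is acyclic with a unique ray `R` from `o`), every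
self-avoiding tree ray `r` starting at a vertex joined to the root shares a tail with `R`: `R (i₀ + k) = r (j + k)` for all `k`.
[cite: LyonsPeresSchramm2006, Thm. 3.12 (proof: "a well-defined special end")] -/
theorem ray_tail_of_ray_from_vertex [Infinite V] (hG : G.Preconnected) {U : Sym2 V → ℝ} {o : V} (hout : ∀ k, ∃ m, k ≤ m ∧ IsOutlet G U o m)
    {R : ℕ → V} (hR : Function.Injective R) (hR0 : R 0 = o) (hRadj : ∀ i, (tree G U o).Adj (R i) (R (i + 1)))
    {r : ℕ → V} (hr : Function.Injective r) (hradj : ∀ i, (tree G U o).Adj (r i) (r (i + 1))) (hreach : (tree G U o).Reachable o (r 0)) :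
    ∃ i₀ j, ∀ k, R (i₀ + k) = r (j + k) := by
  classical
  obtain ⟨q⟩ := hreach
  set P : (tree G U o).Walk o (r 0) := q.toPath.1 with hPdef
  have hP : P.IsPath := q.toPath.2
  -- the last index `j` at which `r` visits the support of `P`
  have hfinJ : {j : ℕ | r j ∈ P.support}.Finite :=
    (P.support.finite_toSet.preimage hr.injOn)
  have hJne : hfinJ.toFinset.Nonempty := ⟨0, hfinJ.mem_toFinset.2 (by simp only [Set.mem_setOf_eq]; exact P.end_mem_support)⟩
  set j := hfinJ.toFinset.max' hJne with hjdef
  have hjmem : r j ∈ P.support := by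
    have := Finset.max'_mem _ hJne
    rw [hfinJ.mem_toFinset] at this
    exact this
  have hjmax : ∀ j', r j' ∈ P.support → j' ≤ j := fun j' hj' => Finset.le_max' _ j' (hfinJ.mem_toFinset.2 hj')
  obtain ⟨i₀, hi₀, hi₀le⟩ := SimpleGraph.Walk.mem_support_iff_exists_getVert.1 hjmem
  -- the spliced sequence
  let s : ℕ → V := fun i => if i ≤ i₀ then P.getVert i else r (j + (i - i₀))
  have hs_le : ∀ i, i ≤ i₀ → s i = P.getVert i := fun i hi => by simp only [s, if_pos hi]
  have hs_gt : ∀ k, s (i₀ + k) = r (j + k) := by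
    intro k
    rcases Nat.eq_zero_or_pos k with rfl | hk
    · simp only [s, Nat.add_zero, if_pos le_rfl, hi₀]
    · simp only [s, if_neg (by omega : ¬ i₀ + k ≤ i₀), Nat.add_sub_cancel_left]
  have hs0 : s 0 = o := by rw [hs_le 0 (Nat.zero_le _)]; exact P.getVert_zero
  have hsadj : ∀ i, (tree G U o).Adj (s i) (s (i + 1)) := by
    intro i
    rcases Nat.lt_or_ge i i₀ with hi | hi
    · rw [hs_le i hi.le, hs_le (i + 1) hi]
      exact P.adj_getVert_succ (lt_of_lt_of_le hi hi₀le)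
    · obtain ⟨k, rfl⟩ : ∃ k, i = i₀ + k := ⟨i - i₀, by omega⟩
      rw [hs_gt k, show i₀ + k + 1 = i₀ + (k + 1) by omega, hs_gt (k + 1), show j + (k + 1) = j + k + 1 by omega]
      exact hradj (j + k)
  have hsinj : Function.Injective s := by
    intro i i' h
    rcases le_or_gt i i₀ with hi | hi <;> rcases le_or_gt i' i₀ with hi' | hi'
    · rw [hs_le i hi, hs_le i' hi'] at h
      exact hP.getVert_injOn (by simp only [Set.mem_setOf_eq]; exact hi.trans hi₀le) (by simp only [Set.mem_setOf_eq]; exact hi'.trans hi₀le) h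
    · exfalso
      obtain ⟨k, rfl⟩ : ∃ k, i' = i₀ + k := ⟨i' - i₀, by omega⟩
      rw [hs_le i hi, hs_gt k] at h
      have hmem : r (j + k) ∈ P.support := h ▸ P.getVert_mem_support i
      have := hjmax _ hmem
      omega
    · exfalso
      obtain ⟨k, rfl⟩ : ∃ k, i = i₀ + k := ⟨i - i₀, by omega⟩
      rw [hs_le i' hi', hs_gt k] at h
      have hmem : r (j + k) ∈ P.support := h.symm ▸ P.getVert_mem_support i'
      have := hjmax _ hmem
      omega
    · obtain ⟨k, rfl⟩ : ∃ k, i = i₀ + k := ⟨i - i₀, by omega⟩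
      obtain ⟨k', rfl⟩ : ∃ k', i' = i₀ + k' := ⟨i' - i₀, by omega⟩
      rw [hs_gt k, hs_gt k'] at h
      have := hr h
      omega
  -- by uniqueness of the ray from the root, `s = R`
  have hsR : s = R := ray_unique hG hout hsinj hR hs0 hR0 hsadj hRadj
  exact ⟨i₀, j, fun k => by rw [← hsR]; exact hs_gt k⟩

omit [DecidableEq V] [G.LocallyFinite] in
/-- Distinct indices of a self-avoiding sequence give distinct consecutive bonds. [folklore] -/
theorem sym2_ray_injective {r : ℕ → V} (hr : Function.Injective r) : Function.Injective fun i => s(r i, r (i + 1)) := by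
  intro i i' h
  simp only at h
  rcases Sym2.eq_iff.1 h with ⟨h1, -⟩ | ⟨h1, h2⟩
  · exact hr h1
  · have := hr h1; have := hr h2; omega

/-- **The backbones of the endpoints of a WMSF bond share a tail** (injective labels, infinite connected locally finite graph, outlets beyond every time at both
endpoints): for `s(x, y) ∈ 𝔉_w(U)` and the (unique) self-avoiding rays `R_x` from `x` in `T(x)`, `R_y` from `y` in `T(y)`: `∃ a b, ∀ k, R_x (a + k) = R_y (b + k)`.
[cite: LyonsPeresSchramm2006, Prop. 3.4 and Thm. 3.12 (proof)] -/
theorem rays_tail_equivalent_of_mem_wmsf [Infinite V] (hG : G.Preconnected) {U : Sym2 V → ℝ} (hU : Function.Injective U) {x y : V}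
    (he : s(x, y) ∈ wmsf G U) (houtx : ∀ k, ∃ m, k ≤ m ∧ IsOutlet G U x m)
    {Rx : ℕ → V} (hRx : Function.Injective Rx) (hRx0 : Rx 0 = x) (hRxadj : ∀ i, (tree G U x).Adj (Rx i) (Rx (i + 1)))
    {Ry : ℕ → V} (hRy : Function.Injective Ry) (hRyadj : ∀ i, (tree G U y).Adj (Ry i) (Ry (i + 1))) :
    ∃ a b, ∀ k, Rx (a + k) = Ry (b + k) := by
  classical
  have hfin := treeEdges_symmDiff_finite_of_mem_wmsf hG hU he
  -- the bonds of `R_y` not in `T(x)` are finitely many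
  have hbad : {i : ℕ | s(Ry i, Ry (i + 1)) ∉ treeEdges G U x}.Finite := by
    refine (hfin.preimage (sym2_ray_injective hRy).injOn).subset fun i hi => ?_
    simp only [Set.mem_preimage, Set.mem_symmDiff, Set.mem_setOf_eq] at hi ⊢
    exact Or.inr ⟨((tree_adj G).1 (hRyadj i)).1, hi⟩
  obtain ⟨N, hN⟩ := hbad.bddAbove
  have hgood : ∀ i, N < i → (tree G U x).Adj (Ry i) (Ry (i + 1)) := by
    intro i hi
    refine (tree_adj G).2 ⟨?_, (hRyadj i).ne⟩
    by_contra h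
    exact absurd (hN h) (not_le.2 hi)
  -- the tail of `R_y` from index `N + 1` is a `T(x)`-ray from an invaded vertex
  have hreach : (tree G U x).Reachable x (Ry (N + 1)) := by
    rw [tree_reachable_iff_mem_invadedRegion]
    obtain ⟨n, a, ha, hu, -⟩ := exists_newDart_of_tree_adj (hgood (N + 1) (Nat.lt_succ_self N))
    exact (mem_invadedRegion G).2 ⟨n + 1, mem_invasion_of_lt_of_mem_sym2 (Nat.lt_succ_self n) ha hu⟩
  obtain ⟨i₀, j, hk⟩ := ray_tail_of_ray_from_vertex hG houtx hRx hRx0 hRxadj (r := fun k => Ry (N + 1 + k))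
    (fun a b hab => by have := hRy hab; omega) (fun i => by
      simpa [Nat.add_assoc] using hgood (N + 1 + i) (by omega)) hreach
  exact ⟨i₀, N + 1 + j, fun k => by rw [hk k]; simp only [Nat.add_assoc]⟩

/-- **Along WMSF paths**: for vertices joined by a path of WMSF bonds (injective labels, outlets beyond every time at every vertex), the backbones share a tail.
[cite: LyonsPeresSchramm2006, Thm. 3.12 (proof: "a well-defined special end for each component")] -/
theorem rays_tail_equivalent_of_wmsf_reachable [Infinite V] (hG : G.Preconnected) {U : Sym2 V → ℝ} (hU : Function.Injective U)
    (hout : ∀ v : V, ∀ k, ∃ m, k ≤ m ∧ IsOutlet G U v m)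
    (hray : ∀ v : V, ∃ R : ℕ → V, Function.Injective R ∧ R 0 = v ∧ ∀ i, (tree G U v).Adj (R i) (R (i + 1))) {x y : V}
    (h : (SimpleGraph.fromEdgeSet (wmsf G U)).Reachable x y)
    {Rx : ℕ → V} (hRx : Function.Injective Rx) (hRx0 : Rx 0 = x) (hRxadj : ∀ i, (tree G U x).Adj (Rx i) (Rx (i + 1)))
    {Ry : ℕ → V} (hRy : Function.Injective Ry) (hRy0 : Ry 0 = y) (hRyadj : ∀ i, (tree G U y).Adj (Ry i) (Ry (i + 1))) :
    ∃ a b, ∀ k, Rx (a + k) = Ry (b + k) := by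
  obtain ⟨p⟩ := h
  induction p generalizing Rx with
  | nil =>
    have := ray_unique hG (hout _) hRx hRy hRx0 hRy0 hRxadj hRyadj
    exact ⟨0, 0, fun k => by rw [this]⟩
  | @cons u v w huv q ih =>
    have he : s(u, v) ∈ wmsf G U := ((SimpleGraph.fromEdgeSet_adj _).1 huv).1
    obtain ⟨Rv, hRv, hRv0, hRvadj⟩ := hray v
    obtain ⟨a, b, hab⟩ := rays_tail_equivalent_of_mem_wmsf hG hU he (hout u) hRx hRx0 hRxadj hRv hRvadj
    obtain ⟨c, e, hce⟩ := ih hRv hRv0 hRvadj hRy0 hRyadj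
    refine ⟨a + c, e + b, fun k => ?_⟩
    calc Rx (a + c + k) = Rx (a + (c + k)) := by rw [Nat.add_assoc]
      _ = Rv (b + (c + k)) := hab (c + k)
      _ = Rv (c + (b + k)) := by rw [Nat.add_left_comm]
      _ = Ry (e + (b + k)) := hce (b + k)
      _ = Ry (e + b + k) := by rw [Nat.add_assoc]

end General

/-! ## `ℤ^d` -/

variable {d : ℕ}

/-- **EVERY WMSF COMPONENT OF `ℤ^d` HAS A CANONICAL END** (`d ≥ 2`, p205010): almost surely, for all `x, y ∈ ℤ^d` joined by a path of WMSF bonds and all self-avoiding rays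
`r_x` from `x` in `T(x)`, `r_y` from `y` in `T(y)` (they exist and are unique, file XXXVII), the rays share a tail: `∃ a b, ∀ k, r_x (a + k) = r_y (b + k)` — the
"special end" of Lyons–Peres–Schramm's proof of Thm 3.12, now on `ℤ^d` for every `d ≥ 2`. [cite: LyonsPeresSchramm2006, Prop. 3.4 and Thm. 3.12 (proof)] -/
theorem ae_rays_tail_equivalent_of_wmsf_reachable (hd : 2 ≤ d) :
    ∀ᵐ U ∂(labelMeasure (Site d)), ∀ x y : Site d, (SimpleGraph.fromEdgeSet (wmsf (zdGraph d) U)).Reachable x y →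
      ∀ rx ry : ℕ → Site d, Function.Injective rx → rx 0 = x → (∀ i, (tree (zdGraph d) U x).Adj (rx i) (rx (i + 1))) →
        Function.Injective ry → ry 0 = y → (∀ i, (tree (zdGraph d) U y).Adj (ry i) (ry (i + 1))) →
        ∃ a b, ∀ k, rx (a + k) = ry (b + k) := by
  haveI : Nonempty (Fin d) := ⟨⟨0, by omega⟩⟩
  haveI : Infinite (Site d) := Pi.infinite_of_right
  filter_upwards [Literature.Barriers.CriticalPhenomena.ae_injective_labelMeasure (V := Site d), ae_forall_root_existsUnique_ray hd] with U hU hall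
  intro x y hxy rx ry hrx hrx0 hrxadj hry hry0 hryadj
  exact rays_tail_equivalent_of_wmsf_reachable zdGraph_preconnected_holds hU (fun v => (hall v).1) (fun v => (hall v).2.exists) hxy
    hrx hrx0 hrxadj hry hry0 hryadj

end Summit.CriticalPhenomena.PercolationContinuityZ3.Theorems.Rsw3
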